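import Summits.CriticalPhenomena.CardyFormulaZ2.Theses.CardySelfDualSegment
import Summits.CriticalPhenomena.CardyFormulaZ2.Theorems.CardyMagicRigidityLoopsToCrossingsStubComparisonGeometry
import Summits.CriticalPhenomena.CardyFormulaZ2.Theorems.CardyMagicRigidityLoopsToCrossingsStubCardyContinuity
import Literature.Probability.Percolation.CornerPercolation
import Literature.Probability.Percolation.CardyFormulaConformalInvariance
import Literature.Probability.Percolation.TriCrossingSandwich
import Literature.Probability.LatticeModels.TriangularLatticeProofs
import Literature.Probability.RandomPlanarGeometry.ImageUnivalent
import Literature.Probability.RandomPlanarGeometry.CollarGeometry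
import Literature.Barriers.CriticalPhenomena.EmbeddingModulusUniquenessProofs

/-!
# Crux `SmirnovBasePoint` (stmt-CriticalPhenomena-5474), line `Sketch`: stub `stub_upperInclusion`

The upper exact inclusion of the sheared two-quad sandwich. Let `R = (Ω; arcs 0–3)` be a conformal
rectangle and `N` an *upper comparison quad* of `R` with parameters `r, m, τ > 0`:

* the arcs `1, 3` of `N` are poked out of `Ω`: every point of `N.arc 1 ∪ N.arc 3` is at distance
  `≥ r` from every point of `Ω`;
* `N` is pulled into `Ω` along the arcs `0, 2`: `Ω ∖ N` consists of thin caps within `τ` of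
  `R.arc 0` or of `R.arc 2`, the points of `N ∩ Ω` are `≥ m` from `R.arc 0 ∪ R.arc 2`, and
  `N.arc 0`, `N.arc 2` lie within `τ` of `R.arc 0`, `R.arc 2`;
* the caps are far apart: `3τ < dist (R.arc 0, R.arc 2)`.

Then, for small mesh `δ`, every `𝕋`-frame crude crossing of `R` with slack `2δ` (an open bond
path of `upTriangleConfig ω` through sites with mesh point in `Ω`, from a site within `2δ` of
`R.arc 0` to a site within `2δ` of `R.arc 2`) is a G02 crossing of `N` at mesh `δ`
(`triCrossing N.carrier δ (N.arc 0) (N.arc 2)`), *given* the owner extraction (stub D1, taken as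
a hypothesis): the open-owner `𝕋`-path of open sites in `Ω` starts in the cap at `R.arc 0` and
ends in the cap at `R.arc 2`; between its last site `a'` in the cap at `R.arc 0` and the first
later site `b'` off `N` (necessarily in the cap at `R.arc 2`) it runs inside `N`
(`PathIn.last_exit`, `PathIn.exit`); the mesh edges `[δa', δx₁]` and `[δx_k, δb']` cross
`∂N` within `δ` of `δa'`, `δb'`, and the crossing points lie on `N.arc 0`, `N.arc 2`
respectively (not on `N.arc 1 ∪ N.arc 3`, which are `≥ r > δ` away from `Ω`; not on the other
low arc, which is near the other, far-away cap). The lower-half sandwich lemma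
`mem_triCrossing_of_pathIn N` (Bollobás–Riordan 2006, Ch. 7, Claim 19) with plate margin `t = δ`
then produces the G02 crossing of `N`.

Sources: B. Bollobás, O. Riordan, *Percolation*, CUP 2006, Ch. 7 (Claim 19 p. 192 and the remark
p. 195); the trimming bookkeeping is folklore.
-/

noncomputable section

namespace Summit.CriticalPhenomena.CardyFormulaZ2.Cruxes.SmirnovBasePoint.ShearedSandwich

open Literature.Probability.RandomPlanarGeometry hiding cardyFunction
open Literature.Probability.Percolation hiding cardyFunction
open Literature.Probability.LatticeModels
open Literature.Barriers.CriticalPhenomena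
open Summit.CriticalPhenomena.CardyFormulaZ2.Cruxes.LoopsToCrossings.OracleSandwich
open Filter Topology Set MeasureTheory Metric

namespace UpperInclusion

/-- **Far-apart caps.** If `3τ < dist p q` for all `p ∈ R.arc 0`, `q ∈ R.arc 2`, then for any two
points `x, y` of the plane `3τ < infDist x (R.arc 0) + dist x y + infDist y (R.arc 2)` (the arcs
are compact and nonempty, so the infima are attained). [folklore] -/
theorem lt_infDist_add_dist_add_infDist (R : ConformalRectangle) {τ : ℝ}
    (hsep : ∀ p ∈ R.arc 0, ∀ q ∈ R.arc 2, 3 * τ < dist p q) (x y : ℂ) :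
    3 * τ < infDist x (R.arc 0) + dist x y + infDist y (R.arc 2) := by
  obtain ⟨p, hp, hpx⟩ := (R.isCompact_arc 0).exists_infDist_eq_dist ⟨_, R.pt_mem_arc_self 0⟩ x
  obtain ⟨q, hq, hqy⟩ := (R.isCompact_arc 2).exists_infDist_eq_dist ⟨_, R.pt_mem_arc_self 2⟩ y
  rw [hpx, hqy, dist_comm x p]
  exact (hsep p hp q hq).trans_le (dist_triangle4 p x y q)

/-- **Boundary contact.** Let `N` be a conformal rectangle with
`frontier N ⊆ (X ∪ Y) ∪ (N.arc 1 ∪ N.arc 3)`, whose arcs `1, 3` are at distance `≥ r > δ` from a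
set `Ω`. If `a' ∼ x` in `𝕋` at mesh `δ > 0`, `δa' ∈ Ω ∖ N` is farther than `δ` from `Y` and
`δx ∈ N`, then `δa'` is within `δ` of `X`: the mesh edge `[δx, δa']` (of length `δ`) leaves the
open set `N` through a frontier point, which can only lie on `X`. [folklore] -/
theorem infDist_le_of_adj_of_not_mem (N : ConformalRectangle) {X Y Ω : Set ℂ}
    (hfr : frontier N.carrier ⊆ (X ∪ Y) ∪ (N.arc 1 ∪ N.arc 3)) {r δ : ℝ} (hδ : 0 < δ)
    (hδr : δ < r) (hb : ∀ z ∈ N.arc 1 ∪ N.arc 3, ∀ w ∈ Ω, r ≤ dist z w)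
    {a' x : Site 2} (hadj : triGraph.Adj a' x)
    (ha'Ω : triMeshPoint δ a' ∈ Ω) (ha'N : triMeshPoint δ a' ∉ N.carrier)
    (hY : ∀ f ∈ Y, δ < dist (triMeshPoint δ a') f)
    (hxN : triMeshPoint δ x ∈ N.carrier) :
    infDist (triMeshPoint δ a') X ≤ δ := by
  have hseg : ¬ segment ℝ (triMeshPoint δ x) (triMeshPoint δ a') ⊆ N.carrier := fun h =>
    ha'N (h (right_mem_segment ℝ _ _))
  obtain ⟨f, hf, hff⟩ := exists_mem_segment_frontier N.isOpen hxN hseg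
  have hfd : dist (triMeshPoint δ a') f ≤ δ := by
    have h1 := dist_le_dist_of_mem_segment hf
      (right_mem_segment ℝ (triMeshPoint δ x) (triMeshPoint δ a'))
    rw [dist_triMeshPoint_of_triGraph_adj hadj.symm, abs_of_pos hδ] at h1
    rwa [dist_comm] at h1
  rcases hfr hff with (hfX | hfY) | hf13
  · exact (infDist_le_dist_of_mem hfX).trans hfd
  · exact absurd hfd (not_le.2 (hY f hfY))
  · have := hb f hf13 _ ha'Ω
    rw [dist_comm] at this
    exfalso
    linarith

end UpperInclusion

open UpperInclusion in
/-- **Stub D (upper exact inclusion).** Given owner extraction (stub D1), for an upper comparison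
quad `N` of `R` (the clauses of stub C) every `𝕋`-frame crude crossing of `R` with slack `2δ` at
small mesh `δ` is a G02 crossing of `N`: the open-owner path (sites in `Ω`) is trimmed to a run
inside `N` entered from a cap site near `arc 0` and left to a cap site near `arc 2` (both within
`δ` of `N.arc 0`, `N.arc 2`), to which `mem_triCrossing_of_pathIn N` applies with plate margin `δ`.
[cite: BollobasRiordan2006, Ch. 7 Claim 19 p. 192 and remark p. 195] -/
theorem stub_upperInclusion :
    (∀ (ω : SiteConfig (Site 2)) (V : Set (Site 2)) (u v : Site 2),
      PathIn (openGraph (upTriangleConfig ω)) V u v → u ≠ v →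
        ∃ a b : Site 2, (a = u ∨ triGraph.Adj u a) ∧ (b = v ∨ triGraph.Adj b v) ∧
          PathIn triGraph (V ∩ ω) a b) →
    ∀ (R N : ConformalRectangle) (r m τ : ℝ), 0 < r → 0 < m → 0 < τ →
      (∀ p ∈ R.arc 0, ∀ q ∈ R.arc 2, 3 * τ < dist p q) →
      (∀ z ∈ N.arc 1 ∪ N.arc 3, ∀ w ∈ R.carrier, r ≤ dist z w) →
      (∀ z ∈ R.carrier, z ∉ N.carrier → infDist z (R.arc 0) ≤ τ ∨ infDist z (R.arc 2) ≤ τ) →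
      (∀ z ∈ N.carrier, z ∈ R.carrier → m ≤ infDist z (R.arc 0) ∧ m ≤ infDist z (R.arc 2)) →
      (∀ z ∈ N.arc 0, infDist z (R.arc 0) ≤ τ) →
      (∀ z ∈ N.arc 2, infDist z (R.arc 2) ≤ τ) →
      ∃ δ₀ > 0, ∀ δ : ℝ, 0 < δ → δ < δ₀ →
        upTriangleConfig ⁻¹' openCrossing
          {y : Site 2 | triMeshPoint δ y ∈ R.carrier}
          {u : Site 2 | infDist (triMeshPoint δ u) (R.arc 0) ≤ 2 * δ}
          {v : Site 2 | infDist (triMeshPoint δ v) (R.arc 2) ≤ 2 * δ} ⊆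
        triCrossing N.carrier δ (N.arc 0) (N.arc 2) := by
  intro hD1 R N r m τ hr hm hτ hsep hb hc hd hf0 hf2
  obtain ⟨δN, hδN, tN, htN, hN⟩ := mem_triCrossing_of_pathIn N
  refine ⟨min (min δN tN) (min r (min (m / 4) (τ / 4))), by positivity, ?_⟩
  intro δ hδ hδlt
  simp only [lt_min_iff] at hδlt
  obtain ⟨⟨hδN', hδtN⟩, hδr, hδm, hδτ⟩ := hδlt
  intro ω' hω'
  rw [mem_preimage, mem_openCrossing_iff] at hω'
  obtain ⟨u, hu, v, hv, huv⟩ := hω'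
  rw [DCT16.mem_openConnIn_iff_pathIn] at huv
  have hu' : infDist (triMeshPoint δ u) (R.arc 0) ≤ 2 * δ := hu
  have hv' : infDist (triMeshPoint δ v) (R.arc 2) ≤ 2 * δ := hv
  set S : Set (Site 2) := {y : Site 2 | triMeshPoint δ y ∈ R.carrier} with hS
  have hsep' := lt_infDist_add_dist_add_infDist R hsep
  -- mesh distances of equal-or-adjacent sites
  have hdist : ∀ {x y : Site 2}, x = y ∨ triGraph.Adj y x →
      dist (triMeshPoint δ x) (triMeshPoint δ y) ≤ δ := by
    rintro x y (rfl | h)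
    · rw [dist_self]; exact hδ.le
    · rw [dist_triMeshPoint_of_triGraph_adj h.symm, abs_of_pos hδ]
  -- a site near `arc 0` and a site near `arc 2` are neither equal nor adjacent
  have hfar : ∀ {x y : Site 2}, infDist (triMeshPoint δ x) (R.arc 0) ≤ τ →
      infDist (triMeshPoint δ y) (R.arc 2) ≤ τ → x = y ∨ triGraph.Adj y x → False := by
    intro x y hx hy hxy
    have := hsep' (triMeshPoint δ x) (triMeshPoint δ y)
    linarith [hdist hxy]
  -- step 0: the crude crossing is nontrivial
  have hne : u ≠ v := fun h => hfar (by linarith) (by linarith) (Or.inl h)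
  -- step 1: owner extraction
  obtain ⟨a, b, hau, hbv, hP⟩ := hD1 ω' S u v huv hne
  have haS : triMeshPoint δ a ∈ R.carrier := hP.left_mem.1
  have hbS : triMeshPoint δ b ∈ R.carrier := hP.right_mem.1
  have ha0 : infDist (triMeshPoint δ a) (R.arc 0) ≤ 3 * δ := by
    have := infDist_le_infDist_add_dist (x := triMeshPoint δ a) (y := triMeshPoint δ u)
      (s := R.arc 0)
    linarith [hdist hau]
  have hb2 : infDist (triMeshPoint δ b) (R.arc 2) ≤ 3 * δ := by
    have := infDist_le_infDist_add_dist (x := triMeshPoint δ b) (y := triMeshPoint δ v)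
      (s := R.arc 2)
    linarith [hdist (hbv.imp id SimpleGraph.Adj.symm)]
  -- step 2: `a` lies in the cap at `arc 0`, `b` in the cap at `arc 2`, both off `N`
  have haN : triMeshPoint δ a ∉ N.carrier := fun h => by
    have := (hd _ h haS).1
    linarith
  have hbN : triMeshPoint δ b ∉ N.carrier := fun h => by
    have := (hd _ h hbS).2
    linarith
  set C : Set (Site 2) :=
    {x : Site 2 | triMeshPoint δ x ∉ N.carrier ∧ infDist (triMeshPoint δ x) (R.arc 0) ≤ τ} with hC
  have haC : a ∈ C := ⟨haN, by linarith⟩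
  have hbC : b ∉ C := fun h => hfar h.2 (by linarith) (Or.inl rfl)
  -- step 3: the last site `a'` of the path in the cap at `arc 0` …
  obtain ⟨a', a'', ha'C, ha'S, ha''C, ha'a'', hP1⟩ := hP.last_exit haC hbC
  have ha''S : a'' ∈ (S ∩ ω') \ C := hP1.left_mem
  have ha''N : triMeshPoint δ a'' ∈ N.carrier := by
    by_contra h
    rcases hc _ ha''S.1.1 h with h0 | h2
    · exact ha''C ⟨h, h0⟩
    · exact hfar ha'C.2 h2 (Or.inr ha'a''.symm)
  -- … and the first later site `b'` off `N`
  set I : Set (Site 2) := {x : Site 2 | triMeshPoint δ x ∈ N.carrier} with hI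
  obtain ⟨b'', b', hb''I, hb'I, hb'S, hb''b', hP2⟩ := hP1.exit (R := I) ha''N hbN
  have hb'N : triMeshPoint δ b' ∉ N.carrier := hb'I
  have hb''N : triMeshPoint δ b'' ∈ N.carrier := hb''I
  have hb'2 : infDist (triMeshPoint δ b') (R.arc 2) ≤ τ := by
    rcases hc _ hb'S.1.1 hb'N with h0 | h2
    · exact absurd ⟨hb'N, h0⟩ hb'S.2
    · exact h2
  -- step 4: boundary contacts at the two ends of the run
  have hfr : frontier N.carrier ⊆ (N.arc 0 ∪ N.arc 2) ∪ (N.arc 1 ∪ N.arc 3) :=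
    frontier_subset_arcs_zero_two N
  have hfr' : frontier N.carrier ⊆ (N.arc 2 ∪ N.arc 0) ∪ (N.arc 1 ∪ N.arc 3) :=
    hfr.trans (by rw [union_comm (N.arc 0)])
  have ha'N0 : infDist (triMeshPoint δ a') (N.arc 0) ≤ δ := by
    refine infDist_le_of_adj_of_not_mem N hfr hδ hδr hb ha'a'' ha'S.1 ha'C.1 (fun f hf => ?_) ha''N
    have := hsep' (triMeshPoint δ a') f
    linarith [hf2 f hf, ha'C.2]
  have hb'N2 : infDist (triMeshPoint δ b') (N.arc 2) ≤ δ := by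
    refine infDist_le_of_adj_of_not_mem N hfr' hδ hδr hb hb''b'.symm hb'S.1.1 hb'N (fun f hf => ?_)
      hb''N
    have := hsep' f (triMeshPoint δ b')
    linarith [hf0 f hf, dist_comm f (triMeshPoint δ b')]
  -- step 5: the trimmed path and the lower-half sandwich lemma for `N`
  set T : Set (Site 2) := insert a' (insert b' (I ∩ ((S ∩ ω') \ C))) with hT
  have hTS : T ⊆ S ∩ ω' := by
    rintro x (rfl | rfl | hx)
    · exact ha'S
    · exact hb'S.1
    · exact hx.2.1
  have hsub : I ∩ ((S ∩ ω') \ C) ⊆ T := fun x hx => mem_insert_of_mem _ (mem_insert_of_mem _ hx)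
  have hpath : PathIn triGraph T a' b' :=
    ((PathIn.of_adj (mem_insert _ _) (hsub hP2.left_mem) ha'a'').trans (hP2.mono hsub)).tail
      hb''b' (mem_insert_of_mem _ (mem_insert _ _))
  refine hN δ δ hδ hδN' hδ.le hδtN.le ω' T a' b' (fun x hx => (hTS hx).2) ?_ ?_ ha'C.1 ha'N0
    hb'N hb'N2 hpath
  · rintro x (rfl | rfl | hx) hxN
    · exact Or.inl ha'N0
    · exact Or.inr hb'N2
    · exact absurd hx.1 hxN
  · intro x hx _
    have hxΩ : triMeshPoint δ x ∈ R.carrier := (hTS hx).1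
    constructor
    · refine hδr.trans_le ((le_infDist ⟨_, N.pt_mem_arc_self 1⟩).2 fun z hz => ?_)
      rw [dist_comm]
      exact hb z (Or.inl hz) _ hxΩ
    · refine hδr.trans_le ((le_infDist ⟨_, N.pt_mem_arc_self 3⟩).2 fun z hz => ?_)
      rw [dist_comm]
      exact hb z (Or.inr hz) _ hxΩ

end Summit.CriticalPhenomena.CardyFormulaZ2.Cruxes.SmirnovBasePoint.ShearedSandwich
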